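import Summits.BirchSwinnertonDyer.Rank1Residual.X2.HidaLimitRoadInt
import Summits.BirchSwinnertonDyer.Rank1Residual.X2.CpIntSeriesCongruenceLimit
import Summits.BirchSwinnertonDyer.Rank1Residual.X11b.AnticyclotomicModuleFinite
import HarnessLib

/-!
# O9 (row B11): road H's INPUTS over the WIDE receptacle `𝓞_{ℂ_p}⟦T⟧` — `HidaLimitInputsIntAt W p` —
# and the kernel transfer to c3♭ `NonsplitIMCEqOnTreeInt` WITHOUT the residual c1 (cell `bsd-eis`,
# seat `bsd-eis-cgshw` g8; route `EisensteinPrimes`, crux 4 `BSDpOnCellC`, line b1; ♭ twin of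
# `X2/HidaLimitInputs.lean` p429440, companion of `X2/HidaLimitRoadInt.lean` p429473)

HONEST FRAMING (cell `bsd-eis`, run/shared/lean/pub/bsd-eis/): ONE hypothesis-shaped `@[conjecture]`
predicate + theorems; nothing asserted; nothing booked; X2 stays CONSTRUCTION-SHAPED; no label or
count moves; no registered stub is attacked or renamed.

## What and why

On the non-split road of record the IMC atom is c3♭ = `NonsplitIMCEqOnTreeInt W p` over k5-c4's
`𝓞_{ℂ_p}`-frames `Q` (Hsieh 2014 Thm. 1 supplies a frame, so the old residual c1 — an `R₀`-descent —
is gone). Road H's output there is `HidaLimitRevDivOnTreeInt` (p429473) and its glue with KY D′♭ is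
`nonsplitIMCEqOnTreeInt_of_hidaLimitRevDivInt_of_muLambdaInt`. This file types road H's INPUTS in the
same ♭ currency and proves the transfer:

* The algebra is `X2/CpIntSeriesCongruenceLimit.lean` (this seat, theorems only): the receptacle is
  NOT Noetherian, so Krull's intersection theorem is replaced there by the analytic closedness lemma
  `CpIntSeries.mem_span_of_forall_mem_sup_pow` (a principal ideal `(Q)` with a UNIT coefficient is
  `p`-adically closed — Gauss lemma p420633 + completeness of `ℂ_p`), giving the one-sided REVERSE
  congruence limit `HidaLimitAlgebra.C_pow_mul_map_mem_span_of_oneSided_congruences_int` across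
  `Λ → 𝓞_{ℂ_p}⟦T⟧`; the unit coefficient of `Q` is KY's D′♭ (`μ = 0`) — the same input the closing uses.
* `HidaLimitInputsIntAt W p` — road H's member data for every `𝓞_{ℂ_p}`-frame `Q`, SIGN-FREE, on
  the binders of `HidaLimitRevDivOnTreeInt`: ∃ a, `(p)^a·(F) ⊆ Fitt_Λ(X_ac^∅)` [KY L.5.1.2] ∧ ∀ m ≥ 1
  ∃ finite `Λ`-module `N_m`, `Q_m ∈ 𝓞_{ℂ_p}⟦T⟧`: `X_ac^∅/p^m ≅ N_m/p^m` [(α) + control — cgshw MEMO-9]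
  ∧ `Fitt_Λ(N_m)·𝓞_{ℂ_p}⟦T⟧ ⊆ (Q_m)` [(d) — MEMO-8] ∧ `(Q_m) + (p)^m = (Q) + (p)^m` [(b)♭: Castella
  2020 §1.5 for road H's own Λ^nr-valued two-variable function, read in `𝓞_{ℂ_p}⟦T⟧` and moved to an
  arbitrary frame `Q` by frame-ideal rigidity — `X11b.R1.imcEqIntAt_iff_of_isBDPLFunctionInt` /
  `X2/NonsplitHalvesIntRigidity` —; the weight-2 specialisation being a BDP function of the p-new
  `f_E` is KY §5 (b) / the c2 VALUE atom's territory (k5-c4 MEMO-1), not re-derived here];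
  and the glue **`nonsplitIMCEqOnTreeInt_of_hidaLimitInputsInt_of_muLambdaInt`**: inputs♭ + D′♭ ⟹
  c3♭, in the kernel (§2 + `CpIntSeries.span_singleton_eq_of_C_pow_mul_mem`). So on the ¬split road of
  record the IMC atom reads `(div♭ ∨ HidaLimitInputsInt) ∧ μλ♭` with NO c1 anywhere.

What this is NOT: not a proof of (α), (b) or (d); KY Thm. D stays PRE; the split sign keeps the `R₀`
road (`SplitIMCEqOnTree`, p416318 / `HidaLimitInputsAt` p429440).

References: Keller–Yin arXiv:2402.12781v2 §5.1 (a)–(e), Lemma 5.1.2, Thm. 5.1.3 [KellerYin2024, PRE];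
Hsieh, Doc. Math. 19 (2014) Thm. 1 [Hsieh2014]; Bosch–Güntzer–Remmert §5.1.2 [BoschGuntzerRemmert1984];
C. Skinner, Pacific J. Math. 283 (2016) §3.1 [Skinner2016PacificMC]; cell memos cgshw MEMO-8 v1.3,
MEMO-9 v1.2, k5-c4 MEMO-1 v1.2.
-/

set_option autoImplicit false

noncomputable section

open scoped Classical MatrixGroups ModularForm

open CongruenceSubgroup WeierstrassCurve NumberField IsDedekindDomain Field PowerSeries
  Literature.RingTheory.FittingIdeal
  Literature.NumberTheory.EllipticCurves Literature.NumberTheory.EllipticCurves.GreenbergSelmer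
  Literature.NumberTheory.EllipticCurves.ModularForms
  Literature.NumberTheory.EllipticCurves.Rank1Residual
  Literature.NumberTheory.EllipticCurves.Rank1Residual.Typed
  Literature.NumberTheory.GaloisRepresentations Literature.NumberTheory.GaloisCohomology
  Literature.NumberTheory.Automorphic
  Summit.BirchSwinnertonDyer.Rank1Residual.X11b.AcSelmer
  Summit.BirchSwinnertonDyer.Rank1Residual.X11b.Halves
  Summit.BirchSwinnertonDyer.Rank1Residual.X11b

/-! ## §3 The ♭ inputs predicate and the glue to c3♭ -/

namespace Summit.BirchSwinnertonDyer.Rank1Residual.X2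

section InputsInt

variable (W : WeierstrassCurve ℚ) [W.IsElliptic] [W.IsGloballyMinimal] (p : ℕ) [Fact p.Prime]

/-- **`HidaLimitInputsIntAt W p` — road H's INPUTS over the wide receptacle `𝓞_{ℂ_p}⟦T⟧`, BOTH signs**
(the ♭ twin of `HidaLimitInputsAt`, p429440): on the binders of `HidaLimitRevDivOnTreeInt` (X2c Heegner
datum, anticyclotomic `κ` with generator `γ`, degree-one `𝔭 ∋ p`, newform, embedding datum, an
`𝓞_{ℂ_p}`-frame `(Ω_K, Ω_p, Q)`) and for every generator `F` of `Ch_Λ(X_ac^∅(E[p^∞]))`: an exponent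
`a` with `(p)^a·(F) ⊆ Fitt_Λ(X_ac^∅)` [finite submodule; KY Lemma 5.1.2], and for every `m ≥ 1` a
finite `Λ`-module `N_m` [`𝔛_{f_m}`, KY §5 (a)], `Q_m ∈ 𝓞_{ℂ_p}⟦T⟧` [`𝓛_{f_m}` read in the wide
receptacle], a `Λ`-isomorphism `X_ac^∅/p^m ≅ N_m/p^m` [(α) — cgshw MEMO-9 — + control], the member
inclusion `Fitt_Λ(N_m)·𝓞_{ℂ_p}⟦T⟧ ⊆ (Q_m)` [(d) — KY Thm. 3.0.8, MEMO-8] and `(Q_m) + (p)^m =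
(Q) + (p)^m` [(b)♭: Castella JIMJ 2020 §1.5 + frame-ideal rigidity across `𝓞_{ℂ_p}`-frames]. TYPED,
not attempted; nothing asserted; every result using it is CONDITIONAL.
[claim: KellerYin2024, status: under-review]
[cite: KellerYin2024, §5.1 (a)–(e), Lemma 5.1.2, Thm. 5.1.3 and Thm. 3.0.8 (arXiv:2402.12781v2)]
[cite: Hsieh2014, Thm. 1 and p. 7 (arXiv:1112.1580) (the receptacle)] -/
@[conjecture]
def HidaLimitInputsIntAt : Prop :=
  ∀ (N : ℕ) [NeZero N] (K : Type) [Field K] [NumberField K] (Dt : ModularParametrizationData W N)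
    (H : HeegnerDatum N (NumberField.discr K)) (ιK : K →+* ℂ) (P : (W.baseChange K).toAffine.Point),
    CellC W p → W.conductorNorm ℤ = N →
    IsImaginaryQuadratic K → NumberField.discr K < -4 → SatisfiesHeegnerHypothesis N K →
    (W.quadraticTwist (NumberField.discr K : ℚ)).entireLFunction 1 ≠ 0 →
    WeierstrassCurve.Affine.Point.map ιK.toRatAlgHom P = heegnerPointComplex Dt H →
    ¬ (p : ℤ) ∣ Dt.c → ¬ IsOfFinAddOrder P →
    ∀ (κ : ZpExtension K p), κ.IsAnticyclotomic →
      ∀ (γ : Field.absoluteGaloisGroup K) [Fact (κ.IsTopGenerator γ)]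
        (𝔭 : HeightOneSpectrum (𝓞 K)), ((p : ℕ) : 𝓞 K) ∈ 𝔭.asIdeal →
        𝔭.asIdeal.ramificationIdx (𝓞 ℚ) = 1 → 𝔭.asIdeal.inertiaDeg (𝓞 ℚ) = 1 →
        ∀ (f : CuspForm (CongruenceSubgroup.Gamma0 N) 2), IsNewformOf W f →
          ∀ (ι' : PadicAlgCl p ≃+* ℂ),
            (∀ (w : InfinitePlace K) (k : 𝓞 K),
              k ∈ 𝔭.asIdeal ↔ ‖ι'.symm (w.embedding (k : K))‖ < 1) →
            ∀ (ΩK : ℂ) (Ωp : ℂ_[p]) (Q : PowerSeries 𝓞_ℂ_[p]), ΩK ≠ 0 → ‖Ωp‖ = 1 →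
              R1.IsBDPLFunctionInt p ι' 𝔭 κ γ f ΩK Ωp Q →
                ∀ F : IwasawaAlgebra p,
                  XAc.charIdeal (W.baseChange K) p κ 𝔭 ∅ γ = Ideal.span {F} →
                  (∃ a : ℕ, Ideal.span {(C (p : ℤ_[p]) : IwasawaAlgebra p)} ^ a * Ideal.span {F} ≤
                      Module.fittingIdeal (IwasawaAlgebra p) (XAc (W.baseChange K) p κ 𝔭 ∅ γ) 0) ∧
                  ∀ m : ℕ, 1 ≤ m →
                    ∃ (Nm : Type) (_ : AddCommGroup Nm) (_ : Module (IwasawaAlgebra p) Nm)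
                      (_ : Module.Finite (IwasawaAlgebra p) Nm) (Qm : PowerSeries 𝓞_ℂ_[p]),
                      Nonempty (((XAc (W.baseChange K) p κ 𝔭 ∅ γ) ⧸
                          ((Ideal.span {(C (p : ℤ_[p]) : IwasawaAlgebra p)}) ^ m •
                            (⊤ : Submodule (IwasawaAlgebra p) (XAc (W.baseChange K) p κ 𝔭 ∅ γ))))
                          ≃ₗ[IwasawaAlgebra p]
                        (Nm ⧸ ((Ideal.span {(C (p : ℤ_[p]) : IwasawaAlgebra p)}) ^ m •
                          (⊤ : Submodule (IwasawaAlgebra p) Nm)))) ∧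
                      (Module.fittingIdeal (IwasawaAlgebra p) Nm 0).map
                          (PowerSeries.map (R1.toCpInt p)) ≤ Ideal.span {Qm} ∧
                      Ideal.span {Qm} ⊔
                          (Ideal.span {(C ((p : ℕ) : 𝓞_ℂ_[p]) : PowerSeries 𝓞_ℂ_[p])}) ^ m =
                        Ideal.span {Q} ⊔
                          (Ideal.span {(C ((p : ℕ) : 𝓞_ℂ_[p]) : PowerSeries 𝓞_ℂ_[p])}) ^ m

end InputsInt

section TransferInt

variable {p : ℕ} [Fact p.Prime]

/-- **Member data ♭ + a unit coefficient of `Q` ⟹ the reverse divisibility, for ONE finite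
`Λ`-module `X`** (level `0` padded with `X` itself; then §2). Pure algebra.
[cite: Skinner2016PacificMC, §3.1 (p. 192)] [cite: KellerYin2024, §5.1 (a)–(e) (shape only)] -/
theorem C_pow_mul_map_mem_of_memberDataInt {X : Type} [AddCommGroup X] [Module (IwasawaAlgebra p) X]
    [Module.Finite (IwasawaAlgebra p) X] {F : IwasawaAlgebra p} {Q : PowerSeries 𝓞_ℂ_[p]} {a n : ℕ}
    (hQ : (‖((coeff n Q : 𝓞_ℂ_[p]) : ℂ_[p])‖ = 1 ∧ ∀ i < n, ‖((coeff i Q : 𝓞_ℂ_[p]) : ℂ_[p])‖ < 1))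
    (hfitt : Ideal.span {(C (p : ℤ_[p]) : IwasawaAlgebra p)} ^ a * Ideal.span {F} ≤
      Module.fittingIdeal (IwasawaAlgebra p) X 0)
    (hmem : ∀ m : ℕ, 1 ≤ m →
      ∃ (Nm : Type) (_ : AddCommGroup Nm) (_ : Module (IwasawaAlgebra p) Nm)
        (_ : Module.Finite (IwasawaAlgebra p) Nm) (Qm : PowerSeries 𝓞_ℂ_[p]),
        Nonempty ((X ⧸ ((Ideal.span {(C (p : ℤ_[p]) : IwasawaAlgebra p)}) ^ m •
            (⊤ : Submodule (IwasawaAlgebra p) X))) ≃ₗ[IwasawaAlgebra p]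
          (Nm ⧸ ((Ideal.span {(C (p : ℤ_[p]) : IwasawaAlgebra p)}) ^ m •
            (⊤ : Submodule (IwasawaAlgebra p) Nm)))) ∧
        (Module.fittingIdeal (IwasawaAlgebra p) Nm 0).map (PowerSeries.map (R1.toCpInt p)) ≤
          Ideal.span {Qm} ∧
        Ideal.span {Qm} ⊔ (Ideal.span {(C ((p : ℕ) : 𝓞_ℂ_[p]) : PowerSeries 𝓞_ℂ_[p])}) ^ m =
          Ideal.span {Q} ⊔ (Ideal.span {(C ((p : ℕ) : 𝓞_ℂ_[p]) : PowerSeries 𝓞_ℂ_[p])}) ^ m) :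
    C (((p : ℕ) : 𝓞_ℂ_[p]) ^ a) * PowerSeries.map (R1.toCpInt p) F ∈
      Ideal.span ({Q} : Set (PowerSeries 𝓞_ℂ_[p])) := by
  have hall : ∀ m : ℕ, ∃ (Nm : Type) (_ : AddCommGroup Nm) (_ : Module (IwasawaAlgebra p) Nm)
      (_ : Module.Finite (IwasawaAlgebra p) Nm) (Qm : PowerSeries 𝓞_ℂ_[p]),
      (1 ≤ m → Nonempty ((X ⧸ ((Ideal.span {(C (p : ℤ_[p]) : IwasawaAlgebra p)}) ^ m •
            (⊤ : Submodule (IwasawaAlgebra p) X))) ≃ₗ[IwasawaAlgebra p]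
          (Nm ⧸ ((Ideal.span {(C (p : ℤ_[p]) : IwasawaAlgebra p)}) ^ m •
            (⊤ : Submodule (IwasawaAlgebra p) Nm))))) ∧
      (1 ≤ m → (Module.fittingIdeal (IwasawaAlgebra p) Nm 0).map (PowerSeries.map (R1.toCpInt p)) ≤
          Ideal.span {Qm}) ∧
      (1 ≤ m → Ideal.span {Qm} ⊔
          (Ideal.span {(C ((p : ℕ) : 𝓞_ℂ_[p]) : PowerSeries 𝓞_ℂ_[p])}) ^ m =
          Ideal.span {Q} ⊔ (Ideal.span {(C ((p : ℕ) : 𝓞_ℂ_[p]) : PowerSeries 𝓞_ℂ_[p])}) ^ m) := by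
    intro m
    rcases Nat.eq_zero_or_pos m with rfl | hm
    · exact ⟨X, inferInstance, inferInstance, inferInstance, Q, fun h ↦ absurd h (by decide),
        fun h ↦ absurd h (by decide), fun h ↦ absurd h (by decide)⟩
    · obtain ⟨Nm, i1, i2, i3, Qm, he, hF, hc⟩ := hmem m hm
      exact ⟨Nm, i1, i2, i3, Qm, fun _ ↦ he, fun _ ↦ hF, fun _ ↦ hc⟩
  choose N iA iM iF Qm he hF hc using hall
  exact @HidaLimitAlgebra.C_pow_mul_map_mem_span_of_oneSided_congruences_int p _ X _ _ _ N iA iM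
    iF F a hfitt Q n hQ Qm (fun m hm ↦ Classical.choice (he m hm)) (fun m hm ↦ hF m hm)
    (fun m hm ↦ hc m hm)

end TransferInt

section GlueInt

variable {W : WeierstrassCurve ℚ} [W.IsElliptic] [W.IsGloballyMinimal] {p : ℕ} [Fact p.Prime]

omit [W.IsGloballyMinimal] in
/-- **Road H closes c3♭ with NO c1**: `HidaLimitInputsIntAt W p` + `NonsplitMuLambdaOnTreeInt W p`
(KY D′♭: `F♭` and `Q` have their first unit coefficient at the same index) ⟹ `NonsplitIMCEqOnTreeInt
W p` (`Ch_Λ(X_ac^∅)·𝓞_{ℂ_p}⟦T⟧ = (Q)` for every `𝓞_{ℂ_p}`-frame at every non-split X2c Heegner datum).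
The unit coefficient of `Q` serves twice: for the analytic Krull step (§1) and for the closing
`CpIntSeries.span_singleton_eq_of_C_pow_mul_mem` (p420633). `X_ac^∅` is finitely generated by the
tree's PROVED `XAc.module_finite_empty`. CONDITIONAL on the two typed hypotheses; nothing booked.
[cite: KellerYin2024, Lemma 5.1.2, Thm. 5.1.3 and proof of Thm. 3.0.8 (arXiv:2402.12781v2)]
[cite: Hsieh2014, Thm. 1 (arXiv:1112.1580)] [cite: Washington1997, §7.1 Prop. 7.2] -/
theorem nonsplitIMCEqOnTreeInt_of_hidaLimitInputsInt_of_muLambdaInt (hin : HidaLimitInputsIntAt W p)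
    (hml : NonsplitMuLambdaOnTreeInt W p) : NonsplitIMCEqOnTreeInt W p := by
  intro N _ K _ _ Dt H ιK P hc hns hN hK hd4 hHN hLt hP hcM hPinf κ hκ γ _ 𝔭 h𝔭 he hf f hfW ι' hι'
    ΩK Ωp Q hΩK hΩp hQ
  obtain ⟨F, hF⟩ :=
    (charIdeal_isPrincipal_holds p (XAc (W.baseChange K) p κ 𝔭 ∅ γ)).principal
  have hchar : XAc.charIdeal (W.baseChange K) p κ 𝔭 ∅ γ = Ideal.span {F} := hF
  obtain ⟨⟨a, hfitt⟩, hmem⟩ := hin N K Dt H ιK P hc hN hK hd4 hHN hLt hP hcM hPinf κ hκ γ 𝔭 h𝔭 he hf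
    f hfW ι' hι' ΩK Ωp Q hΩK hΩp hQ F hchar
  obtain ⟨n, hFn, hQn⟩ := hml N K Dt H ιK P hc hns hN hK hd4 hHN hLt hP hcM hPinf κ hκ γ 𝔭 h𝔭 he
    hf f hfW ι' hι' ΩK Ωp Q hΩK hΩp hQ F hchar
  haveI : Module.Finite (IwasawaAlgebra p) (XAc (W.baseChange K) p κ 𝔭 ∅ γ) :=
    XAc.module_finite_empty κ 𝔭 γ
  have ha : C (((p : ℕ) : 𝓞_ℂ_[p]) ^ a) * PowerSeries.map (R1.toCpInt p) F ∈
      Ideal.span ({Q} : Set (PowerSeries 𝓞_ℂ_[p])) :=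
    C_pow_mul_map_mem_of_memberDataInt hQn hfitt hmem
  unfold R1.IMCEqIntAt
  rw [hchar, Ideal.map_span, Set.image_singleton]
  exact (CpIntSeries.span_singleton_eq_of_C_pow_mul_mem ha hQn hFn).symm

omit [W.IsGloballyMinimal] in
/-- **The ¬split IMC atom from either divisibility source**: `(c3♭-div ∨ HidaLimitInputsInt) ∧ c3♭-μλ
⟹ c3♭` (`nonsplitIMCEqOnTreeInt_of_divInt_of_muLambdaInt`, p429473, for the Kolyvagin half).
CONDITIONAL; nothing booked. [folklore] -/
theorem nonsplitIMCEqOnTreeInt_of_divInt_or_hidaLimitInputsInt_of_muLambdaInt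
    (h : NonsplitKolyvaginDivOnTreeInt W p ∨ HidaLimitInputsIntAt W p)
    (hml : NonsplitMuLambdaOnTreeInt W p) : NonsplitIMCEqOnTreeInt W p := by
  rcases h with hd | hin
  · exact nonsplitIMCEqOnTreeInt_of_divInt_of_muLambdaInt hd hml
  · exact nonsplitIMCEqOnTreeInt_of_hidaLimitInputsInt_of_muLambdaInt hin hml

end GlueInt

end Summit.BirchSwinnertonDyer.Rank1Residual.X2

end
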